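import Mathlib
import Literature.Computability.AlgebraicComplexity.StandardFamilies
import Summits.ValiantsHypothesis.ValiantsHypothesis.Theses.RefutationDegree
import Summits.ValiantsHypothesis.ValiantsHypothesis.Theorems.RefutationDegreeDefs
import Summits.ValiantsHypothesis.ValiantsHypothesis.Theorems.RefutationDegreeRefutationBarrierPencilCoeff

/-!
# Arcs kill bounded-degree SOS — crux RefutationBarrier (stmt-ValiantsHypothesis-5642), line Sketch-ideator1, stub `stub_notHasSosRef_of_contactSeq` (T1)

If the equations of Rep(n,m) admit asymptotic pseudo-solutions of contact `D` (`ContactSeq n m D`: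
genuine complex points `A_k` with `(1 + ‖A_k‖)^(D-m) · |P.coeff μ (A_k)| → 0` for every `μ`), then
Rep(n,m) has no Hermitian-SOS refutation with products of degree `≤ D` (`¬ HasSosRef n m D`).

Proof: evaluate the SOS identity at the conjugate point `(A_k, conj A_k)`; Hermitian squares become
`|q(A_k, Ā_k)|² ≥ 0`, the equation terms become `2 Re (h_μ · P.coeff μ)(A_k)`, so
`1 ≤ 2 Σ_μ |h_μ(A_k, Ā_k)| · |P.coeff μ (A_k)|`.  The degree bound and the degree dichotomy for the
equations (`F_μ ≠ 0 ⇒ deg P.coeff μ ≥ m`; `F_μ = 0` is excluded by the contact hypothesis) give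
`deg h_μ ≤ D - m`, hence `|h_μ(A_k, Ā_k)| ≤ ‖h_μ‖₁ (1 + ‖A_k‖)^(D-m)` and the right-hand side tends
to `0` — contradiction.

The vocabulary (`Unk pencil defect eqn cj HasSosRef ContactSeq`) is the route's Defs file
`Theorems/RefutationDegreeDefs.lean`; the pencil-coefficient facts (`coeff_defect`,
`le_totalDegree_coeff_defect`, `eval_cj`, `eval_mul_cj`, `norm_eval_le`) are the helper file
`Theorems/RefutationDegreeRefutationBarrierPencilCoeff.lean`.
-/


-- `Summit.ValiantsHypothesis.ValiantsHypothesis.…` is the tree's mandated single-conjunct layout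
-- (Sub = Summit), so the duplicated namespace component is intended.
set_option linter.dupNamespace false

noncomputable section

namespace Summit.ValiantsHypothesis.ValiantsHypothesis.Theorems.RefutationDegree

open scoped BigOperators
open Filter Topology MvPolynomial
open Literature.Computability.AlgebraicComplexity (perPoly)
open Summit.ValiantsHypothesis.ValiantsHypothesis.Theses.RefutationDegree


section ArcsKillSos

variable {n m : ℕ}

/-- Renaming along an injective map of the variables preserves the total degree. [folklore] -/
private theorem totalDegree_rename_injective {σ τ R : Type*} [CommSemiring R] {f : σ → τ}
    (hf : Function.Injective f) (p : MvPolynomial σ R) :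
    (MvPolynomial.rename f p).totalDegree = p.totalDegree := by
  classical
  refine le_antisymm (MvPolynomial.totalDegree_rename_le f p) (Finset.sup_le fun d hd => ?_)
  have hd' : Finsupp.mapDomain f d ∈ (MvPolynomial.rename f p).support := by
    rw [MvPolynomial.support_rename_of_injective hf]
    exact Finset.mem_image_of_mem _ hd
  have hsum : ((Finsupp.mapDomain f d).sum fun _ e => e) = d.sum fun _ e => e :=
    Finsupp.sum_mapDomain_index_inj hf
  calc (d.sum fun _ e => e) = (Finsupp.mapDomain f d).sum fun _ e => e := hsum.symm
    _ ≤ (MvPolynomial.rename f p).totalDegree := MvPolynomial.le_totalDegree hd'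

/-- The sup norm of the conjugate point `(a, conj a)` of the doubled variables is at most (in fact
equal to) the sup norm of `a`. [folklore] -/
theorem norm_conjPt_le {σ : Type*} [Fintype σ] (a : σ → ℂ) :
    ‖(Sum.elim a (starRingEnd ℂ ∘ a) : σ ⊕ σ → ℂ)‖ ≤ ‖a‖ := by
  refine (pi_norm_le_iff_of_nonneg (norm_nonneg a)).2 fun u => ?_
  rcases u with u | u
  · exact norm_le_pi_norm a u
  · change ‖(starRingEnd ℂ) (a u)‖ ≤ ‖a‖
    rw [Complex.norm_conj]
    exact norm_le_pi_norm a u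

/-- POLYNOMIAL GROWTH at conjugate points: `|p(a, conj a)| ≤ ‖p‖₁ · (1 + ‖a‖)^d` whenever
`deg p ≤ d`. [folklore] -/
theorem norm_eval_conjPt_le {σ : Type*} [Fintype σ] (p : MvPolynomial (σ ⊕ σ) ℂ) (a : σ → ℂ)
    {d : ℕ} (hd : p.totalDegree ≤ d) :
    ‖MvPolynomial.eval (Sum.elim a (starRingEnd ℂ ∘ a)) p‖ ≤
      (∑ α ∈ p.support, ‖MvPolynomial.coeff α p‖) * (1 + ‖a‖) ^ d := by
  refine (norm_eval_le p _).trans ?_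
  refine mul_le_mul_of_nonneg_left ?_ (Finset.sum_nonneg fun α _ => norm_nonneg _)
  calc (1 + ‖(Sum.elim a (starRingEnd ℂ ∘ a) : σ ⊕ σ → ℂ)‖) ^ p.totalDegree
      ≤ (1 + ‖a‖) ^ p.totalDegree :=
        pow_le_pow_left₀ (by positivity) (add_le_add le_rfl (norm_conjPt_le a)) _
    _ ≤ (1 + ‖a‖) ^ d := pow_le_pow_right₀ (le_add_of_nonneg_right (norm_nonneg _)) hd

/-- POSITIVITY IS FREE: at a conjugate point `(a, conj a)` a Hermitian-SOS identity
`Σ_i q_i·cj q_i + Σ_{μ ∈ s} (h_μ g_μ + cj (h_μ g_μ)) + 1 = 0` forces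
`1 ≤ 2 Σ_{μ ∈ s} |h_μ(a, ā)| · |g_μ(a, ā)|` (the squares evaluate to `|q_i(a, ā)|² ≥ 0`, the
equation terms to `2 Re (h_μ g_μ)(a, ā)`). [folklore] -/
theorem one_le_two_mul_sum_of_sos {σ ι : Type*} (s : Finset ι) {k : ℕ}
    (q : Fin k → MvPolynomial (σ ⊕ σ) ℂ) (h g : ι → MvPolynomial (σ ⊕ σ) ℂ) (v : σ ⊕ σ → ℂ)
    (hsum : ∑ i, q i * cj σ (q i) + ∑ μ ∈ s, (h μ * g μ + cj σ (h μ * g μ)) + 1 = 0)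
    (hv : ∀ u, v (Sum.inr u) = (starRingEnd ℂ) (v (Sum.inl u))) :
    1 ≤ 2 * ∑ μ ∈ s, ‖MvPolynomial.eval v (h μ)‖ * ‖MvPolynomial.eval v (g μ)‖ := by
  -- evaluate the identity at the conjugate point
  have h1 : (∑ i, (Complex.normSq (MvPolynomial.eval v (q i)) : ℂ)) +
      ∑ μ ∈ s, (MvPolynomial.eval v (h μ * g μ) +
        (starRingEnd ℂ) (MvPolynomial.eval v (h μ * g μ))) + 1 = 0 := by
    have := congrArg (MvPolynomial.eval v) hsum
    simpa only [map_add, map_sum, map_one, map_zero, eval_mul_cj v hv, eval_cj v hv] using this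
  -- take real parts
  have h2 := congrArg Complex.re h1
  simp only [Complex.add_re, Complex.re_sum, Complex.ofReal_re, Complex.conj_re, Complex.one_re,
    Complex.zero_re] at h2
  have hsq : 0 ≤ ∑ i, Complex.normSq (MvPolynomial.eval v (q i)) :=
    Finset.sum_nonneg fun i _ => Complex.normSq_nonneg _
  have hre : ∀ μ ∈ s,
      -((MvPolynomial.eval v (h μ * g μ)).re + (MvPolynomial.eval v (h μ * g μ)).re) ≤
        2 * (‖MvPolynomial.eval v (h μ)‖ * ‖MvPolynomial.eval v (g μ)‖) := by
    intro μ _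
    have hw : |(MvPolynomial.eval v (h μ * g μ)).re| ≤
        ‖MvPolynomial.eval v (h μ)‖ * ‖MvPolynomial.eval v (g μ)‖ := by
      rw [← norm_mul, ← map_mul]
      exact Complex.abs_re_le_norm _
    have hn := neg_le_abs (MvPolynomial.eval v (h μ * g μ)).re
    linarith
  have hT : -(∑ μ ∈ s,
      ((MvPolynomial.eval v (h μ * g μ)).re + (MvPolynomial.eval v (h μ * g μ)).re)) ≤
        2 * ∑ μ ∈ s, ‖MvPolynomial.eval v (h μ)‖ * ‖MvPolynomial.eval v (g μ)‖ := by
    rw [Finset.mul_sum, ← Finset.sum_neg_distrib]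
    exact Finset.sum_le_sum hre
  linarith

/-- The holomorphic copy `eqn_μ` of the equation `P.coeff μ` evaluates at the conjugate point
`(a, conj a)` to `P.coeff μ (a)`. [folklore] -/
theorem eval_eqn_conjPt (a : Unk n m → ℂ) (μ : (Fin n × Fin n) →₀ ℕ) :
    MvPolynomial.eval (Sum.elim a (starRingEnd ℂ ∘ a)) (eqn n m μ) =
      MvPolynomial.eval a ((defect n m).coeff μ) := by
  rw [eqn, MvPolynomial.eval_rename, Sum.elim_comp_inl]

/-- CONTACT EXCLUDES CONSTANT EQUATIONS: if `(1 + ‖A_k‖)^e · |P.coeff μ (A_k)| → 0` for an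
equation in the support of `P`, then `F_μ ≠ 0` (otherwise `P.coeff μ = -c_μ` is a nonzero constant
and the quantity is `≥ |c_μ| > 0`). [folklore] -/
theorem coeff_det_pencil_ne_zero_of_tendsto {e : ℕ} {μ : (Fin n × Fin n) →₀ ℕ}
    (hμ : μ ∈ (defect n m).support) {A : ℕ → (Unk n m → ℂ)}
    (hA : Tendsto (fun k => (1 + ‖A k‖) ^ e * ‖MvPolynomial.eval (A k) ((defect n m).coeff μ)‖)
      atTop (𝓝 0)) :
    ((pencil n m).det).coeff μ ≠ 0 := by
  intro hF
  have hPμ : (defect n m).coeff μ =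
      -MvPolynomial.C (MvPolynomial.coeff μ (perPoly (Fin n) ℂ)) := by
    rw [coeff_defect, hF, zero_sub]
  have hc0 : MvPolynomial.coeff μ (perPoly (Fin n) ℂ) ≠ 0 := by
    intro h0
    apply MvPolynomial.mem_support_iff.mp hμ
    rw [hPμ, h0, map_zero, neg_zero]
  have hle : ∀ k, ‖MvPolynomial.coeff μ (perPoly (Fin n) ℂ)‖ ≤
      (1 + ‖A k‖) ^ e * ‖MvPolynomial.eval (A k) ((defect n m).coeff μ)‖ := by
    intro k
    rw [hPμ, map_neg, MvPolynomial.eval_C, norm_neg]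
    exact le_mul_of_one_le_left (norm_nonneg _)
      (one_le_pow₀ (le_add_of_nonneg_right (norm_nonneg _)))
  exact hc0 (norm_le_zero_iff.mp (ge_of_tendsto' hA hle))

/-- DEGREE BOOKKEEPING: for an equation `μ ∈ supp P` with `F_μ ≠ 0` and a nonzero multiplier `p`
with `deg (p · eqn_μ) ≤ D` one has `deg p + m ≤ D` (`ℂ[a, ā]` is a domain and `deg eqn_μ ≥ m`).
[folklore] -/
theorem totalDegree_add_le_of_mul_eqn {D : ℕ} {μ : (Fin n × Fin n) →₀ ℕ}
    (hμ : μ ∈ (defect n m).support) (hF : ((pencil n m).det).coeff μ ≠ 0)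
    {p : MvPolynomial (Unk n m ⊕ Unk n m) ℂ} (hp : p ≠ 0)
    (hD : (p * eqn n m μ).totalDegree ≤ D) : p.totalDegree + m ≤ D := by
  have heqn : eqn n m μ ≠ 0 := by
    intro h0
    apply MvPolynomial.mem_support_iff.mp hμ
    have hinj := MvPolynomial.rename_injective (R := ℂ)
      (Sum.inl : Unk n m → Unk n m ⊕ Unk n m) Sum.inl_injective
    apply hinj
    rw [map_zero]
    exact h0
  have hdeg : (eqn n m μ).totalDegree = ((defect n m).coeff μ).totalDegree :=
    totalDegree_rename_injective Sum.inl_injective _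
  calc p.totalDegree + m ≤ p.totalDegree + (eqn n m μ).totalDegree := by
        rw [hdeg]
        exact Nat.add_le_add_left (le_totalDegree_coeff_defect n m μ hF) _
    _ = (p * eqn n m μ).totalDegree := (MvPolynomial.totalDegree_mul_of_isDomain hp heqn).symm
    _ ≤ D := hD

/-- **T1 — arcs kill bounded-degree SOS** (`D_SOS(n,m) ≥ m + κ(n,m)`): asymptotic pseudo-solutions
of contact `D` of Rep(n,m) exclude every Hermitian-SOS refutation with products of degree `≤ D`.
Positivity is free because evaluation at a conjugate pair `(A_k, conj A_k)` is a positive functional: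
it turns the SOS identity into `1 ≤ 2 Σ_μ |h_μ(A_k, Ā_k)| · |P.coeff μ (A_k)|`, and the right-hand
side is `≤ 2 Σ_μ ‖h_μ‖₁ (1 + ‖A_k‖)^(D-m) |P.coeff μ (A_k)| → 0`. [folklore] -/
theorem stub_notHasSosRef_of_contactSeq (n m D : ℕ) : ContactSeq n m D → ¬ HasSosRef n m D := by
  rintro ⟨A, hA⟩ ⟨k, q, h, -, hh, hsum⟩
  -- no equation in the support is constant, so every multiplier has degree ≤ D - m
  have hF : ∀ μ ∈ (defect n m).support, ((pencil n m).det).coeff μ ≠ 0 := fun μ hμ =>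
    coeff_det_pencil_ne_zero_of_tendsto hμ (hA μ)
  have hdeg : ∀ μ ∈ (defect n m).support, h μ ≠ 0 → (h μ).totalDegree ≤ D - m := by
    intro μ hμ hne
    have := totalDegree_add_le_of_mul_eqn hμ (hF μ hμ) hne (hh μ)
    omega
  -- the majorant tends to 0
  have hT : Tendsto (fun j => (2 : ℝ) * ∑ μ ∈ (defect n m).support,
      (∑ α ∈ (h μ).support, ‖MvPolynomial.coeff α (h μ)‖) *
        ((1 + ‖A j‖) ^ (D - m) * ‖MvPolynomial.eval (A j) ((defect n m).coeff μ)‖))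
      atTop (𝓝 0) := by
    have h2 : Tendsto (fun j => ∑ μ ∈ (defect n m).support,
        (∑ α ∈ (h μ).support, ‖MvPolynomial.coeff α (h μ)‖) *
          ((1 + ‖A j‖) ^ (D - m) * ‖MvPolynomial.eval (A j) ((defect n m).coeff μ)‖))
        atTop (𝓝 (∑ μ ∈ (defect n m).support,
          (∑ α ∈ (h μ).support, ‖MvPolynomial.coeff α (h μ)‖) * 0)) :=
      tendsto_finsetSum _ fun μ _ => (hA μ).const_mul _
    simp only [mul_zero, Finset.sum_const_zero] at h2
    simpa only [mul_zero] using h2.const_mul (2 : ℝ)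
  -- the minorant: 1 ≤ majorant at every step
  have hge : ∀ j, (1 : ℝ) ≤ 2 * ∑ μ ∈ (defect n m).support,
      (∑ α ∈ (h μ).support, ‖MvPolynomial.coeff α (h μ)‖) *
        ((1 + ‖A j‖) ^ (D - m) * ‖MvPolynomial.eval (A j) ((defect n m).coeff μ)‖) := by
    intro j
    have hv : ∀ u, Sum.elim (A j) (starRingEnd ℂ ∘ A j) (Sum.inr u) =
        (starRingEnd ℂ) (Sum.elim (A j) (starRingEnd ℂ ∘ A j) (Sum.inl u)) := fun u => rfl
    refine (one_le_two_mul_sum_of_sos _ q h _ _ hsum hv).trans ?_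
    refine mul_le_mul_of_nonneg_left (Finset.sum_le_sum fun μ hμ => ?_) zero_le_two
    rw [eval_eqn_conjPt, ← mul_assoc]
    refine mul_le_mul_of_nonneg_right ?_ (norm_nonneg _)
    by_cases hne : h μ = 0
    · rw [hne, map_zero, norm_zero]
      exact mul_nonneg (Finset.sum_nonneg fun α _ => norm_nonneg _) (pow_nonneg (by positivity) _)
    · exact norm_eval_conjPt_le (h μ) (A j) (hdeg μ hμ hne)
  have h10 : (1 : ℝ) ≤ 0 := ge_of_tendsto' hT hge
  linarith

end ArcsKillSos

end Summit.ValiantsHypothesis.ValiantsHypothesis.Theorems.RefutationDegree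

end
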